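import Literature.Probability.RandomPlanarGeometry.LoewnerFarField
import Literature.Probability.RandomPlanarGeometry.LoewnerFlow
import Literature.Probability.RandomPlanarGeometry.LoewnerHullConnected
import Literature.Probability.RandomPlanarGeometry.HydrodynamicMaps
import HarnessLib

/-!
# The half-plane capacity of the Loewner hulls is `2t`; the hulls of a chain exhaust no bounded set

Proof-only file (no definitions, no named facts). G. F. Lawler, *Conformally Invariant Processes
in the Plane*, AMS (2005), Ch. 4 §4.1, Thm. 4.6 / Prop. 4.4 and eq. (4.6): for the chordal
Loewner chain `ġ_t(z) = 2/(g_t(z) − U_t)` driven by a continuous function, "`g_t` is the unique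
conformal transformation of `H_t` onto `ℍ` with `g_t(z) − z → 0`", "`g_t(z) = z + 2t/z + O(|z|⁻²)`",
i.e. **`hcap(K_t) = 2t`**; and G. F. Lawler, O. Schramm, W. Werner, *Conformal restriction: the
chordal case*, J. Amer. Math. Soc. **16** (2003), proof of Lemma 8.3 (4) ("`K_∞` is a.s.
unbounded. […] One could also use the fact that the half-plane capacity of `K_t` is `2t`").

From the tree's far-field expansion of the Loewner map (`Loewner.FarRegime.norm_g_sub_expansion_le`
of `LoewnerFarField`: `g_t(z) = z + 2t/z + (2/z²) ∫₀ᵗ W + O(α⁴ ‖z‖)` for `‖z‖ ≥ 64 (K + √t)`) and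
the half-plane capacity of hydrodynamically normalised maps (`hcap`, `IsHydrodynamicMap` of
`HydrodynamicMaps`, with the bound `hcap ≤ 288 r²` for hulls in a disc of radius `r`,
`IsHydrodynamicMap.hcap_le`), all PROVED:

* `Loewner.tendsto_mul_map_sub_self` — `z (g_t(z) − z) → 2t` as `z → ∞`;
* `Loewner.isHydrodynamicMap_of_eqOn` — the conformal equivalence `g_t : ℍ ∖ K_t → ℍ`
  (`Loewner.exists_conformalEquiv_map_holds`) is hydrodynamically normalised;
* `Loewner.hcap_hull_eq` — **`hcap(K_t) = 2t`**;
* `Loewner.two_mul_le_of_hull_subset_closedBall` — `K_t ⊆ B̄(x, r)` forces `2t ≤ 288 r²`;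
* `Loewner.not_isBounded_iUnion_hull` — **`K_∞ = ⋃_t K_t` is unbounded** for every continuous
  driving function (the deterministic content of [LSW] Lemma 8.3 (4)).
-/

noncomputable section

open Set Filter Topology Metric Bornology
open UpperHalfPlane (upperHalfPlaneSet)
open scoped NNReal

namespace Literature.Probability.RandomPlanarGeometry

namespace Loewner

variable {W : ℝ≥0 → ℝ}

/-- **`z (g_t(z) − z) → 2t` as `z → ∞`** (the whole plane, `z → ∞` in `cocompact ℂ`): from the
far-field expansion `‖g_t(z) − z − 2t/z − (2/z²) ∫₀ᵗ W‖ ≤ 32 α⁴ ‖z‖`, `α = (K + √t)/‖z‖`, so that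
`‖z (g_t(z) − z) − 2t‖ ≤ 32 (K + √t)⁴/‖z‖² + 2 K t/‖z‖`. Lawler (2005), eq. (4.6):
`g_t(z) = z + 2t/z + O(|z|⁻²)`. [cite: Lawler2005, Ch. 4 §4.1 eq. (4.6)] -/
theorem tendsto_mul_map_sub_self (hW : Continuous W) (t : ℝ≥0) :
    Tendsto (fun z ↦ z * (map W t z - z)) (cocompact ℂ) (𝓝 (((2 * t : ℝ) : ℂ))) := by
  obtain ⟨K, hK0, hK⟩ := exists_forall_norm_driving_sub_le hW t 0
  have hKb : ∀ u ∈ Icc (0 : ℝ) t, |W u.toNNReal| ≤ K := fun u hu ↦ by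
    have := hK u hu
    rwa [sub_zero, Complex.norm_real, Real.norm_eq_abs] at this
  set L : ℝ := K + Real.sqrt t with hL
  have hL0 : 0 ≤ L := by positivity
  set R : ℝ := 64 * L + 1 with hR
  have hR0 : 0 < R := by positivity
  -- the error bound beyond radius `R`
  have hbound : ∀ z : ℂ, R ≤ ‖z‖ →
      ‖z * (map W t z - z) - ((2 * t : ℝ) : ℂ)‖ ≤ 32 * L ^ 4 / ‖z‖ ^ 2 + 2 * (K * t) / ‖z‖ := by
    intro z hz
    have hzpos : 0 < ‖z‖ := hR0.trans_le hz
    have hz0 : z ≠ 0 := norm_pos_iff.1 hzpos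
    have hfar : FarRegime W z t K := ⟨hW, hKb, by linarith, hzpos⟩
    obtain ⟨g, hg⟩ := hfar.exists_sol
    have hmap : map W t z = g t := by
      have := hfar.map_eq hg (s := t) ⟨t.coe_nonneg, le_rfl⟩
      rwa [Real.toNNReal_coe] at this
    have hexp := hfar.norm_g_sub_expansion_le hg
    set I : ℂ := ∫ s in (0 : ℝ)..t, (W s.toNNReal : ℂ) with hI
    have hIle : ‖I‖ ≤ K * t := hfar.norm_integral_W_le
    -- algebra: `z (g t - z) - 2t = z (g t - z - 2t/z - 2 I/z²) + 2 I / z`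
    have halg : z * (map W t z - z) - ((2 * t : ℝ) : ℂ) =
        z * (g t - z - 2 * t / z - 2 / z ^ 2 * I) + 2 * I / z := by
      rw [hmap]
      push_cast
      field_simp
      ring
    rw [halg]
    calc ‖z * (g t - z - 2 * t / z - 2 / z ^ 2 * I) + 2 * I / z‖
        ≤ ‖z * (g t - z - 2 * t / z - 2 / z ^ 2 * I)‖ + ‖2 * I / z‖ := norm_add_le _ _
      _ = ‖z‖ * ‖g t - z - 2 * t / z - 2 / z ^ 2 * I‖ + 2 * ‖I‖ / ‖z‖ := by
          rw [norm_mul, norm_div, norm_mul, Complex.norm_two]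
      _ ≤ ‖z‖ * (32 * ((K + Real.sqrt t) / ‖z‖) ^ 4 * ‖z‖) + 2 * (K * t) / ‖z‖ := by
          gcongr
      _ = 32 * L ^ 4 / ‖z‖ ^ 2 + 2 * (K * t) / ‖z‖ := by
          rw [hL]
          field_simp
  -- the error tends to `0` along `cocompact ℂ`
  have hnorm : Tendsto (fun z : ℂ ↦ ‖z‖) (cocompact ℂ) atTop := tendsto_norm_cocompact_atTop
  have herr : Tendsto (fun z : ℂ ↦ 32 * L ^ 4 / ‖z‖ ^ 2 + 2 * (K * t) / ‖z‖) (cocompact ℂ) (𝓝 0) := by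
    have h1 : Tendsto (fun z : ℂ ↦ 32 * L ^ 4 / ‖z‖ ^ 2) (cocompact ℂ) (𝓝 0) :=
      tendsto_const_nhds.div_atTop (tendsto_pow_atTop two_ne_zero |>.comp hnorm)
    have h2 : Tendsto (fun z : ℂ ↦ 2 * (K * t) / ‖z‖) (cocompact ℂ) (𝓝 0) :=
      tendsto_const_nhds.div_atTop hnorm
    simpa using h1.add h2
  refine tendsto_iff_norm_sub_tendsto_zero.2 (squeeze_zero_norm' ?_ herr)
  filter_upwards [hnorm.eventually (eventually_ge_atTop R)] with z hz
  rw [Real.norm_of_nonneg (norm_nonneg _)]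
  exact hbound z hz

/-- **The Loewner map `g_t : ℍ ∖ K_t → ℍ` is hydrodynamically normalised** (`g_t(z) − z → 0` at
`∞`, the tree's `tendsto_map_sub_self_holds`), for any conformal equivalence agreeing with
`Loewner.map W t` on `ℍ ∖ K_t` (such as the one of `exists_conformalEquiv_map_holds`). Lawler
(2005), Thm. 4.6 / Prop. 4.4. [cite: Lawler2005, Ch. 4 §4.1 Thm. 4.6] -/
theorem isHydrodynamicMap_of_eqOn (hW : Continuous W) (t : ℝ≥0)
    {φ : ConformalEquiv (upperHalfPlaneSet \ hull W t) upperHalfPlaneSet}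
    (hφ : EqOn φ (map W t) (upperHalfPlaneSet \ hull W t)) : IsHydrodynamicMap (hull W t) φ := by
  have h := (tendsto_map_sub_self_holds hW t).mono_left
    (inf_le_inf_left (cocompact ℂ) (principal_mono.2
      (show upperHalfPlaneSet \ hull W t ⊆ upperHalfPlaneSet from fun _ hz ↦ hz.1)))
  refine h.congr' ?_
  filter_upwards [mem_inf_of_right (mem_principal_self _)] with z hz
  rw [hφ hz]

/-- **`hcap(K_t) = 2t`**: the half-plane capacity of the Loewner hull at time `t` (computed with
any conformal equivalence `ℍ ∖ K_t → ℍ` agreeing with `g_t`) is `2t` — both `hcap` and `2t` are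
the limit of `z (g_t(z) − z)` at `∞` in `ℍ ∖ K_t`. Lawler (2005), Ch. 4 §4.1 (the half-plane
capacity parametrisation `a(t) = 2t`, Thm. 4.6 / eq. (4.6)). [cite: Lawler2005, Ch. 4 §4.1 Thm. 4.6] -/
theorem hcap_hull_eq (hW : Continuous W) (t : ℝ≥0)
    {φ : ConformalEquiv (upperHalfPlaneSet \ hull W t) upperHalfPlaneSet}
    (hφ : EqOn φ (map W t) (upperHalfPlaneSet \ hull W t)) : hcap (hull W t) φ = 2 * t := by
  have hH := isHydrodynamicMap_of_eqOn hW t hφ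
  have hb : IsBounded (hull W t ∩ upperHalfPlaneSet) :=
    ((isBounded_closedHull hW t).subset (hull_subset_closedHull W t)).subset inter_subset_left
  haveI := IsHydrodynamicMap.neBot_cocompact_inf hb
  have h1 := hH.tendsto_mul_sub_self hb
  have h2 : Tendsto (fun z ↦ z * (φ z - z)) (cocompact ℂ ⊓ 𝓟 (upperHalfPlaneSet \ hull W t))
      (𝓝 (((2 * t : ℝ) : ℂ))) := by
    refine ((tendsto_mul_map_sub_self hW t).mono_left inf_le_left).congr' ?_
    filter_upwards [mem_inf_of_right (mem_principal_self _)] with z hz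
    rw [hφ hz]
  exact_mod_cast tendsto_nhds_unique h1 h2

/-- **A Loewner hull inside a disc of radius `r` has `2t ≤ 288 r²`** (`hcap(K_t) = 2t` and
`hcap ≤ 288 r²` for hulls in `B̄(x, r)`, `IsHydrodynamicMap.hcap_le`; Lawler (2005), (3.9):
`hcap(A) ≤ rad(A)²`). [cite: Lawler2005, Ch. 4 §4.1 Thm. 4.6 with §3.4 (3.9)] -/
theorem two_mul_le_of_hull_subset_closedBall (hW : Continuous W) {t : ℝ≥0} {x r : ℝ} (hr : 0 < r)
    (h : hull W t ⊆ closedBall (x : ℂ) r) : 2 * (t : ℝ) ≤ 288 * r ^ 2 := by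
  obtain ⟨φ, hφ⟩ := exists_conformalEquiv_map_holds hW t
  rw [← hcap_hull_eq hW t hφ]
  exact (isHydrodynamicMap_of_eqOn hW t hφ).hcap_le (inter_subset_left.trans h) hr

/-- **`K_∞ = ⋃_t K_t` is unbounded** for the Loewner chain of any continuous driving function:
the hulls `K_t`, `t > 144 r²`, do not fit in a disc of radius `r` (the deterministic content of
[LSW] Lemma 8.3 (4), "`K_∞` is a.s. unbounded. […] One could also use the fact that the
half-plane capacity of `K_t` is `2t`"). [cite: LawlerSchrammWerner2003Restriction, Lemma 8.3 (4) and its proof] -/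
theorem not_isBounded_iUnion_hull (hW : Continuous W) : ¬ IsBounded (⋃ t, hull W t) := by
  intro hb
  obtain ⟨R, hR⟩ := hb.subset_closedBall 0
  set r : ℝ := max R 1 with hr
  have hr0 : 0 < r := lt_of_lt_of_le one_pos (le_max_right _ _)
  set t : ℝ≥0 := ⟨144 * r ^ 2 + 1, by positivity⟩ with ht
  have hsub : hull W t ⊆ closedBall (((0 : ℝ) : ℂ)) r := by
    rw [Complex.ofReal_zero]
    exact ((subset_iUnion (hull W) t).trans hR).trans (closedBall_subset_closedBall (le_max_left _ _))
  have h := two_mul_le_of_hull_subset_closedBall hW hr0 hsub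
  have htv : (t : ℝ) = 144 * r ^ 2 + 1 := rfl
  rw [htv] at h
  linarith

end Loewner

end Literature.Probability.RandomPlanarGeometry

end
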